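import Mathlib
import Literature.Analysis.FluidPDE.AxisymmetricReflection
import Literature.Analysis.FluidPDE.KNSSMildCompactness
import Literature.Analysis.FluidPDE.KNSSTypeIRateSelection
import Summits.NavierStokesRegularity.OSWSelfSimilar.TypeIIInnerLimitCaseBStanding
import HarnessLib
/-!
# Case A from the standing hypotheses, and the assembled (I-2)/(I-3) dichotomy for an unbounded axisymmetric solution
# (zone Z1 TEMPLATE §T1.4-I, kernel modulo (AX-L) in Case A only)

HONEST FRAMING (cell ns-blowup GROUP B «PROFILE SEARCH», zone Z1; D-0035/D-0074): part XXII of the Z1 dictionary.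
Pre-limit data throughout: `u` classical (`ν = 1`, unforced) on `[0, T⋆) × ℝ³` with AXISYMMETRIC slices, bounded with
bounded energy on closed sub-slabs, bounded initial swirl (K8's standing hypotheses), and — the template's own
hypothesis — UNBOUNDED on `[0, T⋆)`.

* `exists_rotZ_eq_meridional` — every point is a rotate of its meridional representative `r e₀ + x₂ e₂`;
  `exists_meridional_zoom_data_of_unbounded` — part XX's near-maxima of the running supremum may be chosen in the
  meridional half-plane (`‖u(t, R_θ x)‖ = ‖u(t, x)‖`); `tendsto_tn_of_zoom_data` — the near-max times tend to `T⋆`;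
  `exists_subseq_tendsto_atTop_of_not_bddAbove` — the Case-A/Case-B split of `dₖ = rₖ/λₖ` along subsequences.
* `innerLimit_const_caseA_standing_under_axisymmetricLiouville` — CASE A (`rₖ/λₖ → d`): the AXIS-centred zoom (centres
  `zₖ e₂`, near-maxima at `dₖ e₀ → d e₀`) has, by the near-vertex extraction `isKNSSBlowupLimit_of_oseenMild_zoom_nearVertex`
  (KNSS Prop 6.1) and part XVIII, an inner object which is constant in space **IF (AX-L) holds**.
* `innerLimit_const_of_unbounded_under_axisymmetricLiouville` — **THE ASSEMBLED STATEMENT**: IF (AX-L) holds, an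
  unbounded axisymmetric solution under the standing hypotheses has a zoom (gauge N-a, max- or axis-centred) converging
  slice-wise locally uniformly along a subsequence to a KNSS blow-up limit `W` with `W(s, ·) ≡ W(s, 0)` for every
  `s < 0` — i.e. the inner object of TEMPLATE (I-2) is of type (I-4)(α), never a non-trivial profile. Case B is
  unconditional (part XXI); only Case A uses (AX-L).

**Nothing here asserts that any solution is unbounded, nor that (AX-L) holds.** «violates: n/a — dictionary»; bears_on
LADDER-NS N5/Z1 → N1 linear core / N0⁻ ((I-2)/(I-3)/(I-4)/(C6)). Author: ns-blowup-profile-eng-1 g7, 2026-08-27.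
-/

open Real Filter Topology Set MeasureTheory Function Bornology
open scoped ENNReal
open Literature.Analysis.FluidPDE

namespace Summit.NavierStokesRegularity.OSWSelfSimilar
namespace TypeIIModulationDictionary

section CaseAStanding

variable {T Mₛ : ℝ} {u : ℝ → EuclideanSpace ℝ (Fin 3) → EuclideanSpace ℝ (Fin 3)}
  {p : ℝ → EuclideanSpace ℝ (Fin 3) → ℝ}

/-- **Meridional representative**: every `x ∈ ℝ³` is rotated by some `R_θ` onto `r(x) e₀ + x₂ e₂` in the closed
meridional half-plane (`θ = −α` if `(x₀, x₁) = r (cos α, sin α)`; `θ = 0` on the axis). [new here — elementary] -/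
theorem exists_rotZ_eq_meridional (x : EuclideanSpace ℝ (Fin 3)) :
    ∃ θ : ℝ, rotZ θ x = EuclideanSpace.single 0 (cylRadius x) + EuclideanSpace.single 2 (x 2) := by
  by_cases hr : cylRadius x = 0
  · obtain ⟨h0, h1⟩ := (cylRadius_eq_zero_iff x).1 hr
    refine ⟨0, ?_⟩
    ext i
    fin_cases i <;> simp [h0, h1, hr]
  · have hr2 : cylRadius x ^ 2 = x 0 ^ 2 + x 1 ^ 2 := cylRadius_sq x
    obtain ⟨θ, hc, hs⟩ := exists_cos_eq_sin_eq (c := x 0 / cylRadius x) (s := -(x 1 / cylRadius x)) (by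
      rw [neg_sq, div_pow, div_pow, ← add_div, div_eq_one_iff_eq (pow_ne_zero 2 hr), hr2])
    refine ⟨θ, ?_⟩
    have h0 : Real.cos θ * x 0 - Real.sin θ * x 1 = cylRadius x := by
      rw [hc, hs]
      field_simp
      linear_combination (-1 : ℝ) * hr2
    have h1 : Real.sin θ * x 0 + Real.cos θ * x 1 = 0 := by
      rw [hc, hs]; ring
    ext i
    fin_cases i <;> simp [h0, h1]

/-- **Meridional zoom data from unboundedness**: for an axisymmetric `u` bounded on closed sub-slabs of `[0, T⋆)` but
unbounded on `[0, T⋆)`, part XX's near-maxima of the running supremum can be taken in the meridional half-plane: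
`tₖ ∈ [T⋆/2, T⋆)`, `λₖ > 0`, `λₖ → 0`, `rₖ ≥ 0`, `λₖ‖u‖ ≤ 1` on `[0, tₖ]`, `λₖ‖u(tₖ, rₖ e₀ + zₖ e₂)‖ → 1`.
[new here — dictionary] -/
theorem exists_meridional_zoom_data_of_unbounded (hT : 0 < T) (haxi : ∀ t, IsAxisymmetric (u t))
    (hbdd : ∀ S < T, ∃ N : ℝ, 0 < N ∧ ∀ t ∈ Icc 0 S, ∀ x, ‖u t x‖ ≤ N)
    (hunb : ∀ N : ℝ, ∃ t ∈ Ico 0 T, ∃ x : EuclideanSpace ℝ (Fin 3), N < ‖u t x‖) :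
    ∃ (tn lamn rn zn : ℕ → ℝ),
      (∀ k, T / 2 ≤ tn k ∧ tn k < T) ∧ (∀ k, 0 < lamn k) ∧ Tendsto lamn atTop (𝓝 0) ∧ (∀ k, 0 ≤ rn k) ∧
      (∀ k, ∀ t ∈ Icc 0 (tn k), ∀ x, lamn k * ‖u t x‖ ≤ 1) ∧
      Tendsto (fun k => lamn k *
        ‖u (tn k) (EuclideanSpace.single 0 (rn k) + EuclideanSpace.single 2 (zn k))‖) atTop (𝓝 1) := by
  obtain ⟨tn, lamn, xn, htn, hlam, hlam0, hgauge, hnear⟩ := exists_zoom_data_of_unbounded hT hbdd hunb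
  choose θ hθ using fun k => exists_rotZ_eq_meridional (xn k)
  refine ⟨tn, lamn, fun k => cylRadius (xn k), fun k => xn k 2, htn, hlam, hlam0,
    fun k => cylRadius_nonneg _, hgauge, hnear.congr fun k => ?_⟩
  simp only
  rw [← hθ k, (haxi _).norm_rotZ_apply]

/-- **The near-max times tend to `T⋆`**: if `u` is bounded on every closed sub-slab `[0, S] × ℝ³` (`S < T⋆`),
`tₖ ∈ [0, T⋆)`, `λₖ > 0`, `λₖ → 0` and `λₖ‖u(tₖ, xₖ)‖ → 1`, then `tₖ → T⋆` (the values `‖u(tₖ, xₖ)‖ ∼ λₖ⁻¹ → ∞` exceed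
every sub-slab bound). [new here — elementary] -/
theorem tendsto_tn_of_zoom_data (hbdd : ∀ S < T, ∃ N : ℝ, 0 < N ∧ ∀ t ∈ Icc 0 S, ∀ x, ‖u t x‖ ≤ N)
    {tn lamn : ℕ → ℝ} {xn : ℕ → EuclideanSpace ℝ (Fin 3)} (htn : ∀ k, 0 ≤ tn k ∧ tn k < T)
    (hlam : ∀ k, 0 < lamn k) (hlam0 : Tendsto lamn atTop (𝓝 0))
    (hnear : Tendsto (fun k => lamn k * ‖u (tn k) (xn k)‖) atTop (𝓝 1)) :
    Tendsto tn atTop (𝓝 T) := by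
  rw [tendsto_order]
  refine ⟨fun S hS => ?_, fun S hS => Eventually.of_forall fun k => (htn k).2.trans hS⟩
  obtain ⟨N, hN, hbN⟩ := hbdd S hS
  have h1 : ∀ᶠ k in atTop, lamn k * N < 1 / 2 := by
    have : Tendsto (fun k => lamn k * N) atTop (𝓝 0) := by simpa using hlam0.mul_const N
    exact this.eventually (gt_mem_nhds (by norm_num))
  have h2 : ∀ᶠ k in atTop, 1 / 2 < lamn k * ‖u (tn k) (xn k)‖ :=
    hnear.eventually (lt_mem_nhds (by norm_num))
  filter_upwards [h1, h2] with k hk1 hk2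
  by_contra hle
  have hb := hbN (tn k) ⟨(htn k).1, not_lt.1 hle⟩ (xn k)
  have : lamn k * ‖u (tn k) (xn k)‖ ≤ lamn k * N := mul_le_mul_of_nonneg_left hb (hlam k).le
  linarith

/-- A real sequence which is not bounded above has a subsequence tending to `+∞` (the Case-B half of the split of
`dₖ = rₖ/λₖ`; the Case-A half is Bolzano–Weierstrass, `tendsto_subseq_of_bounded`). [new here — elementary] -/
theorem exists_subseq_tendsto_atTop_of_not_bddAbove {d : ℕ → ℝ} (hd : ¬ BddAbove (Set.range d)) :
    ∃ ψ : ℕ → ℕ, StrictMono ψ ∧ Tendsto (d ∘ ψ) atTop atTop := by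
  have hfreq : ∀ n : ℕ, ∃ᶠ k in atTop, (n : ℝ) < d k := by
    intro n
    by_contra h
    rw [Filter.not_frequently] at h
    obtain ⟨K, hK⟩ := eventually_atTop.1 h
    apply hd
    have h1 : BddAbove (d '' Set.Iio K) := ((Set.finite_Iio K).image d).bddAbove
    have h2 : BddAbove (Set.Iic (n : ℝ)) := bddAbove_Iic
    refine (h1.union h2).mono ?_
    rintro _ ⟨k, rfl⟩
    by_cases hk : k < K
    · exact Or.inl ⟨k, hk, rfl⟩
    · exact Or.inr (not_lt.1 (hK k (not_lt.1 hk)))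
  obtain ⟨ψ, hψ, hlt⟩ := Filter.extraction_forall_of_frequently hfreq
  exact ⟨ψ, hψ, tendsto_atTop_mono (fun n => (hlt n).le) tendsto_natCast_atTop_atTop⟩

/-- **TEMPLATE (I-3), CASE A FROM THE STANDING HYPOTHESES ⇒ CONSTANT INNER OBJECT, IF (AX-L) HOLDS.** Let `u` be
classical (`ν = 1`, unforced) on `[0, T⋆) × ℝ³` with axisymmetric slices, bounded with bounded energy on closed
sub-slabs, with bounded initial swirl `|x_h| |u_θ(0)| ≤ Mₛ`; let `tₖ ∈ [t₁, T⋆)` (`t₁ > 0`), `λₖ > 0`, `λₖ → 0`, with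
meridional near-max points `rₖ e₀ + zₖ e₂`, `λₖ‖u‖ ≤ 1` on `[0, tₖ]`, `λₖ‖u(tₖ, rₖ e₀ + zₖ e₂)‖ → 1`, and CASE A:
`rₖ/λₖ → d`. Then the AXIS-CENTRED zoom `y ↦ λₖ u(tₖ + λₖ² s, zₖ e₂ + λₖ y)` (near-maxima at `(rₖ/λₖ) e₀ → d e₀`)
converges along a subsequence, slice-wise locally uniformly, to a KNSS blow-up limit `W`, and IF (AX-L) holds then
`W(s, y) = W(s, 0)` for all `s < 0`, `y`. KNSS Prop 6.1 near-vertex form + parts XVIII/XX. [new here — dictionary;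
conditional on (AX-L)] -/
theorem innerLimit_const_caseA_standing_under_axisymmetricLiouville
    (hAXL : Summit.NavierStokesRegularity.NavierStokesRegularity.AxisymmetricLiouvilleBoundedSwirl)
    (hT : 0 < T) (hu : IsClassicalNSSolutionOn (Ico 0 T) 1 0 u p) (haxi : ∀ t, IsAxisymmetric (u t))
    (hE : ∀ S < T, ∃ C : ℝ≥0∞, C < ⊤ ∧ ∀ t ∈ Icc 0 S, ∫⁻ x, ‖u t x‖ₑ ^ 2 ≤ C)
    (hbdd : ∀ S < T, ∃ N : ℝ, 0 < N ∧ ∀ t ∈ Icc 0 S, ∀ x, ‖u t x‖ ≤ N) (hMₛ : ∀ x, |swirl (u 0) x| ≤ Mₛ)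
    {tn lamn rn zn : ℕ → ℝ} {t₁ : ℝ} (ht₁ : 0 < t₁) (htn : ∀ k, t₁ ≤ tn k ∧ tn k < T)
    (hlam : ∀ k, 0 < lamn k) (hlam0 : Tendsto lamn atTop (𝓝 0))
    (hgauge : ∀ k, ∀ t ∈ Icc 0 (tn k), ∀ x, lamn k * ‖u t x‖ ≤ 1)
    (hnear : Tendsto (fun k => lamn k *
      ‖u (tn k) (EuclideanSpace.single 0 (rn k) + EuclideanSpace.single 2 (zn k))‖) atTop (𝓝 1))
    {d : ℝ} (hcaseA : Tendsto (fun k => rn k / lamn k) atTop (𝓝 d)) :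
    ∃ (φ : ℕ → ℕ) (W : ℝ → EuclideanSpace ℝ (Fin 3) → EuclideanSpace ℝ (Fin 3)), StrictMono φ ∧
      IsKNSSBlowupLimit W ∧
      (∀ s < 0, TendstoLocallyUniformly
        (fun k => (lamn (φ k) • stPull (lamn (φ k) ^ 2) (lamn (φ k)) (tn (φ k))
          (EuclideanSpace.single 2 (zn (φ k))) u) s) (W s) atTop) ∧
      ∀ s < 0, ∀ y : EuclideanSpace ℝ (Fin 3), W s y = W s 0 := by
  set xc : ℕ → EuclideanSpace ℝ (Fin 3) := fun k => EuclideanSpace.single 2 (zn k) with hxc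
  set A : ℕ → ℝ := fun k => -tn k / lamn k ^ 2 with hA
  set B : ℕ → ℝ := fun k => (T - tn k) / lamn k ^ 2 with hB
  set w : ℕ → ℝ → EuclideanSpace ℝ (Fin 3) → EuclideanSpace ℝ (Fin 3) :=
    fun k => lamn k • stPull (lamn k ^ 2) (lamn k) (tn k) (xc k) u with hw_def
  have hBpos : ∀ k, 0 < B k := fun k => div_pos (sub_pos.2 (htn k).2) (pow_pos (hlam k) 2)
  have hAlim : Tendsto A atTop atBot := by
    have hl2 : Tendsto (fun k => lamn k ^ 2) atTop (𝓝[>] 0) := by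
      refine tendsto_nhdsWithin_iff.2 ⟨by simpa using hlam0.pow 2, Eventually.of_forall fun k => ?_⟩
      exact pow_pos (hlam k) 2
    have hinv : Tendsto (fun k => (lamn k ^ 2)⁻¹) atTop atTop := tendsto_inv_nhdsGT_zero.comp hl2
    have hmaj : Tendsto (fun k => -t₁ * (lamn k ^ 2)⁻¹) atTop atBot :=
      hinv.const_mul_atTop_of_neg (by linarith)
    refine tendsto_atBot_mono (fun k => ?_) hmaj
    have hl2k : 0 < lamn k ^ 2 := pow_pos (hlam k) 2
    show -tn k / lamn k ^ 2 ≤ -t₁ * (lamn k ^ 2)⁻¹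
    rw [div_eq_mul_inv]
    exact mul_le_mul_of_nonneg_right (by linarith [(htn k).1]) (inv_nonneg.2 hl2k.le)
  have hw : ∀ k, IsClassicalNSSolutionOn (Ioo (A k) (B k)) 1 0 (w k)
      (lamn k ^ 2 • stPull (lamn k ^ 2) (lamn k) (tn k) (xc k) p) :=
    fun k => zoom_isClassical hu (hlam k) (tn k) (xc k)
  have hmild : ∀ k, ∀ s t : ℝ, A k < s → s < t → t < B k → ∀ x,
      w k t x = Literature.Analysis.UnboundedOperators.heatExtension (w k s) (t - s) x -
        oseenDuhamel 1 s (w k) (w k) t x :=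
    fun k s t hs hst ht x => zoom_oseenMild hu hE hbdd (hlam k) (tn k) (xc k) hs hst ht x
  have hbd1 : ∀ k, ∀ τ ∈ Ioc (A k) 0, ∀ x, ‖w k τ x‖ ≤ 1 := by
    intro k τ hτ x
    have hl2k : 0 < lamn k ^ 2 := pow_pos (hlam k) 2
    have h1 : 0 ≤ tn k + lamn k ^ 2 * τ := by
      have : -tn k / lamn k ^ 2 < τ := hτ.1
      rw [div_lt_iff₀ hl2k] at this; linarith
    have h2 : tn k + lamn k ^ 2 * τ ≤ tn k := by nlinarith [hτ.2]
    have h := hgauge k (tn k + lamn k ^ 2 * τ) ⟨h1, h2⟩ (xc k + lamn k • x)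
    simpa [hw_def, stPull_apply, norm_smul, abs_of_pos (hlam k)] using h
  -- the near-max points of the axis-centred zoom: `yₖ = (rₖ/λₖ) e₀ → d e₀`
  set yv : ℕ → EuclideanSpace ℝ (Fin 3) := fun k => (rn k / lamn k) • EuclideanSpace.single 0 (1 : ℝ) with hyv
  have hy : Tendsto yv atTop (𝓝 (d • EuclideanSpace.single 0 (1 : ℝ))) := hcaseA.smul_const _
  have hpt : ∀ k, xc k + lamn k • yv k = EuclideanSpace.single 0 (rn k) + EuclideanSpace.single 2 (zn k) := by
    intro k
    have hl : lamn k ≠ 0 := (hlam k).ne'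
    ext i
    fin_cases i
    · simp [hxc, hyv]; field_simp
    · simp [hxc, hyv]
    · simp [hxc, hyv]
  have hnearpt : Tendsto (fun k => ‖w k 0 (yv k)‖) atTop (𝓝 1) := by
    refine hnear.congr fun k => ?_
    simp only [hw_def, Pi.smul_apply, stPull_apply, norm_smul, Real.norm_eq_abs, abs_of_pos (hlam k),
      mul_zero, add_zero]
    rw [hpt k]
  obtain ⟨φ, W, hφ, hW, hconv⟩ :=
    isKNSSBlowupLimit_of_oseenMild_zoom_nearVertex hAlim hBpos hw hmild hbd1 hy hnearpt
  refine ⟨φ, W, hφ, hW, hconv, ?_⟩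
  -- pointwise convergence of the axis-centred zoom along the subsequence, then part XVIII under (AX-L)
  have hlim : ∀ s < 0, ∀ y, Tendsto (fun n => lamn (φ n) • u (tn (φ n) + lamn (φ n) ^ 2 * s)
      (xc (φ n) + lamn (φ n) • y)) atTop (𝓝 (W s y)) := by
    intro s hs y
    have h := ((hconv s hs).tendstoLocallyUniformlyOn (s := univ)).tendsto_at (mem_univ y)
    exact h.congr fun n => by simp [hw_def, stPull_apply]
  have htT : Tendsto tn atTop (𝓝 T) :=
    tendsto_tn_of_zoom_data hbdd (fun k => ⟨ht₁.le.trans (htn k).1, (htn k).2⟩) hlam hlam0 hnear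
  exact innerLimit_apply_eq_of_axisCentred_zoom_under_axisymmetricLiouville hAXL one_pos hT hu
    (fun t _ => haxi t) (fun S hS => (hbdd S hS).imp fun N hN => hN.2) hMₛ (htT.comp hφ.tendsto_atTop)
    (fun n => (htn (φ n)).2) (hlam0.comp hφ.tendsto_atTop) (fun n => by simp [hxc]) hlim hW

/-- **TEMPLATE §T1.4-I ASSEMBLED: the inner object of an unbounded axisymmetric solution is constant in space, IF
(AX-L) HOLDS.** Let `u` be classical (`ν = 1`, unforced) on `[0, T⋆) × ℝ³` (`T⋆ > 0`) with axisymmetric slices,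
bounded with bounded energy on every closed sub-slab, with bounded initial swirl, and UNBOUNDED on `[0, T⋆)`. IF the
axisymmetric Liouville conjecture (AX-L) holds, then there are zoom data `tₖ ∈ [T⋆/2, T⋆)`, `λₖ → 0`, centres `cₖ`
and a subsequence along which the gauge N-a zoom `y ↦ λₖ u(tₖ + λₖ² s, cₖ + λₖ y)` converges slice-wise locally
uniformly to a KNSS blow-up limit `W` (`|W| ≤ 1 = sup |W|`, smooth bounded ancient mild) with `W(s, y) = W(s, 0)` for
all `s < 0`, `y` — type (I-4)(α). (Split `rₖ/λₖ` bounded / unbounded along a subsequence; Case B is part XXI and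
uses no conjecture, Case A is the previous theorem.) [new here — dictionary; conditional on (AX-L)] -/
theorem innerLimit_const_of_unbounded_under_axisymmetricLiouville
    (hAXL : Summit.NavierStokesRegularity.NavierStokesRegularity.AxisymmetricLiouvilleBoundedSwirl)
    (hT : 0 < T) (hu : IsClassicalNSSolutionOn (Ico 0 T) 1 0 u p) (haxi : ∀ t, IsAxisymmetric (u t))
    (hE : ∀ S < T, ∃ C : ℝ≥0∞, C < ⊤ ∧ ∀ t ∈ Icc 0 S, ∫⁻ x, ‖u t x‖ₑ ^ 2 ≤ C)
    (hbdd : ∀ S < T, ∃ N : ℝ, 0 < N ∧ ∀ t ∈ Icc 0 S, ∀ x, ‖u t x‖ ≤ N) (hMₛ : ∀ x, |swirl (u 0) x| ≤ Mₛ)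
    (hunb : ∀ N : ℝ, ∃ t ∈ Ico 0 T, ∃ x : EuclideanSpace ℝ (Fin 3), N < ‖u t x‖) :
    ∃ (tn lamn : ℕ → ℝ) (cn : ℕ → EuclideanSpace ℝ (Fin 3)) (φ : ℕ → ℕ)
      (W : ℝ → EuclideanSpace ℝ (Fin 3) → EuclideanSpace ℝ (Fin 3)),
      (∀ k, T / 2 ≤ tn k ∧ tn k < T) ∧ (∀ k, 0 < lamn k) ∧ Tendsto lamn atTop (𝓝 0) ∧
      (∀ k, ∀ t ∈ Icc 0 (tn k), ∀ x, lamn k * ‖u t x‖ ≤ 1) ∧ StrictMono φ ∧ IsKNSSBlowupLimit W ∧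
      (∀ s < 0, TendstoLocallyUniformly
        (fun k => (lamn (φ k) • stPull (lamn (φ k) ^ 2) (lamn (φ k)) (tn (φ k)) (cn (φ k)) u) s) (W s) atTop) ∧
      ∀ s < 0, ∀ y : EuclideanSpace ℝ (Fin 3), W s y = W s 0 := by
  obtain ⟨tn, lamn, rn, zn, htn, hlam, hlam0, hrn, hgauge, hnear⟩ :=
    exists_meridional_zoom_data_of_unbounded hT haxi hbdd hunb
  have hT2 : 0 < T / 2 := by positivity
  by_cases hbA : BddAbove (Set.range fun k => rn k / lamn k)
  · -- Case A along a subsequence: `rₖ/λₖ → d`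
    obtain ⟨C, hC⟩ := hbA
    obtain ⟨d, -, ψ, hψ, hd⟩ := tendsto_subseq_of_bounded (Metric.isBounded_Icc (0 : ℝ) C)
      (x := fun k => rn k / lamn k) fun k => ⟨div_nonneg (hrn k) (hlam k).le, hC ⟨k, rfl⟩⟩
    obtain ⟨φ, W, hφ, hW, hconv, hconst⟩ :=
      innerLimit_const_caseA_standing_under_axisymmetricLiouville hAXL hT hu haxi hE hbdd hMₛ
        (tn := tn ∘ ψ) (lamn := lamn ∘ ψ) (rn := rn ∘ ψ) (zn := zn ∘ ψ) hT2 (fun k => htn (ψ k))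
        (fun k => hlam (ψ k)) (hlam0.comp hψ.tendsto_atTop) (fun k => hgauge (ψ k))
        (hnear.comp hψ.tendsto_atTop) hd
    exact ⟨tn, lamn, fun k => EuclideanSpace.single 2 (zn k), ψ ∘ φ, W, htn, hlam, hlam0, hgauge,
      hψ.comp hφ, hW, hconv, hconst⟩
  · -- Case B along a subsequence: `rₖ/λₖ → ∞` (part XXI, unconditional)
    obtain ⟨ψ, hψ, hd⟩ := exists_subseq_tendsto_atTop_of_not_bddAbove hbA
    obtain ⟨φ, W, hφ, hW, hconv, hconst⟩ :=
      innerLimit_const_caseB_standing hu haxi hE hbdd (tn := tn ∘ ψ) (lamn := lamn ∘ ψ) (rn := rn ∘ ψ)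
        (zn := zn ∘ ψ) hT2 (fun k => htn (ψ k)) (fun k => hlam (ψ k)) (hlam0.comp hψ.tendsto_atTop)
        (fun k => hgauge (ψ k)) (hnear.comp hψ.tendsto_atTop) hd
    exact ⟨tn, lamn, fun k => EuclideanSpace.single 0 (rn k) + EuclideanSpace.single 2 (zn k), ψ ∘ φ, W, htn,
      hlam, hlam0, hgauge, hψ.comp hφ, hW, hconv, hconst⟩

end CaseAStanding

end TypeIIModulationDictionary
end Summit.NavierStokesRegularity.OSWSelfSimilar
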